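import Literature.Combinatorics.Sahi2008.Percolation
import Literature.Probability.LatticeModels.ProdBernoulliIndependence
import HarnessLib

/-!
# `NoHeavyLowerTail` (stmt-CriticalPhenomena-4575) — mixed moments of hitting events: inclusion–exclusion over the miss probabilities

Support file, seat `prim-l12-p5` (gen 8), `--supports stmt-CriticalPhenomena-4575`.  No definitions, no named facts, no sorries, standard axioms.
Infrastructure for the order-`n` bridges "Sahi's `E_n` of a hitting family = universal polynomial in the miss probabilities" (gen 6 did `n = 4` through the
complement expansion; the seat's exchangeable `C₅`/`C₆` files take the moments as hypotheses): for hitting events `H_A = {ω | ∃ a ∈ A, a ∈ ω}` of the product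
weight `bernoulliWeight p` on `2^ι`,

* `prod_ind_hit_apply_eq_sum` — pointwise inclusion–exclusion `∏_{j∈B} 1_{H_{A_j}} = Σ_{R ⊆ B} (−1)^{|R|} 1_{M(R)}`, `M(R) = {ω | ∀ c ∈ ⋃_{j∈R} A_j, c ∉ ω}`
  (a product of miss indicators is the miss indicator of the union);
* `ex_finset_sum`, `ex_mul_const` — linearity of the tree's expectation `ex` over finite sums;
* **`ex_prod_ind_hit`** — `E(∏_{j∈B} 1_{H_{A_j}}) = Σ_{R ⊆ B} (−1)^{|R|} ∏_{c ∈ ⋃_{j∈R} A_j} (1 − p_c)` (the mixed moments that Sahi's set-partition form of `E_n`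
  consumes), and `ex_ind_hit` — `E(1_{H_A}) = 1 − ∏_{c∈A}(1 − p_c)`.
-/

namespace Summit.CriticalPhenomena.PercolationContinuityZ3.Theorems

namespace SahiHitting

open Finset MeasureTheory Literature.Combinatorics.Sahi2008
open Literature.Probability.Percolation.DecisionTree (ind ind_of_mem ind_of_not_mem ind_nonneg)
open Literature.Probability.LatticeModels (prodBernoulli prodBernoulli_real_forall_notMem)

variable {α : Type*} [Fintype α]

/-- Linearity of `ex` over finite sums. [folklore] -/
theorem ex_finset_sum (μ : α → ℝ) {β : Type*} (s : Finset β) (F : β → α → ℝ) :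
    ex μ (fun x => ∑ b ∈ s, F b x) = ∑ b ∈ s, ex μ (F b) := by
  simp only [ex, Finset.mul_sum]
  rw [Finset.sum_comm]

/-- `E(c·f) = c·E(f)` with the constant written as a pointwise product. [folklore] -/
theorem ex_const_mul (μ : α → ℝ) (c : ℝ) (f : α → ℝ) : ex μ (fun x => c * f x) = c * ex μ f := by
  simp only [ex, Finset.mul_sum]
  exact Finset.sum_congr rfl fun x _ => by ring

variable {ι : Type*}

omit [Fintype α] in
/-- A product of miss indicators is the miss indicator of the union: `∏_{j∈R} 1_{M_{A_j}}(ω) = 1_{M(⋃_{j∈R} A_j)}(ω)`. [folklore] -/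
theorem prod_ind_miss_apply [DecidableEq ι] {k : ℕ} (A : Fin k → Finset ι) (R : Finset (Fin k)) (ω : Set ι) :
    ∏ j ∈ R, ind {ω : Set ι | ∀ c ∈ A j, c ∉ ω} ω = ind {ω : Set ι | ∀ c ∈ R.biUnion A, c ∉ ω} ω := by
  by_cases h : ∀ j ∈ R, ∀ c ∈ A j, c ∉ ω
  · rw [ind_of_mem (show ω ∈ {ω : Set ι | ∀ c ∈ R.biUnion A, c ∉ ω} from by
        intro c hc; obtain ⟨j, hj, hcj⟩ := Finset.mem_biUnion.mp hc; exact h j hj c hcj)]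
    exact Finset.prod_eq_one fun j hj => ind_of_mem (show ω ∈ {ω : Set ι | ∀ c ∈ A j, c ∉ ω} from h j hj)
  · simp only [not_forall, not_not, exists_prop] at h
    obtain ⟨j, hj, c, hc, hcω⟩ := h
    rw [ind_of_not_mem (show ω ∉ {ω : Set ι | ∀ c ∈ R.biUnion A, c ∉ ω} from
        fun hω => hω c (Finset.mem_biUnion.mpr ⟨j, hj, hc⟩) hcω)]
    exact Finset.prod_eq_zero hj (ind_of_not_mem (show ω ∉ {ω : Set ι | ∀ c ∈ A j, c ∉ ω} from fun hω => hω c hc hcω))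

omit [Fintype α] in
/-- The hitting indicator is one minus the miss indicator. [folklore] -/
theorem ind_hit_apply_eq (A : Finset ι) (ω : Set ι) :
    ind {ω : Set ι | ∃ a ∈ A, a ∈ ω} ω = 1 - ind {ω : Set ι | ∀ c ∈ A, c ∉ ω} ω := by
  by_cases h : ∃ a ∈ A, a ∈ ω
  · rw [ind_of_mem (show ω ∈ {ω : Set ι | ∃ a ∈ A, a ∈ ω} from h),
      ind_of_not_mem (show ω ∉ {ω : Set ι | ∀ c ∈ A, c ∉ ω} from fun hω => by
        obtain ⟨a, ha, haω⟩ := h; exact hω a ha haω)]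
    norm_num
  · rw [ind_of_not_mem (show ω ∉ {ω : Set ι | ∃ a ∈ A, a ∈ ω} from h),
      ind_of_mem (show ω ∈ {ω : Set ι | ∀ c ∈ A, c ∉ ω} from fun c hc hcω => h ⟨c, hc, hcω⟩)]
    norm_num

omit [Fintype α] in
/-- **Pointwise inclusion–exclusion for hitting indicators**:
`∏_{j∈B} 1_{H_{A_j}}(ω) = Σ_{R ⊆ B} (−1)^{|R|} 1_{M(⋃_{j∈R} A_j)}(ω)`. [folklore] -/
theorem prod_ind_hit_apply_eq_sum [DecidableEq ι] {k : ℕ} (A : Fin k → Finset ι) (B : Finset (Fin k)) (ω : Set ι) :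
    ∏ j ∈ B, ind {ω : Set ι | ∃ a ∈ A j, a ∈ ω} ω
      = ∑ R ∈ B.powerset, (-1 : ℝ) ^ R.card * ind {ω : Set ι | ∀ c ∈ R.biUnion A, c ∉ ω} ω := by
  have h1 : ∏ j ∈ B, ind {ω : Set ι | ∃ a ∈ A j, a ∈ ω} ω
      = ∏ j ∈ B, ((-1 : ℝ) * ind {ω : Set ι | ∀ c ∈ A j, c ∉ ω} ω + 1) :=
    Finset.prod_congr rfl fun j _ => by rw [ind_hit_apply_eq]; ring
  rw [h1, Finset.prod_add]
  refine Finset.sum_congr rfl fun R hR => ?_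
  rw [Finset.prod_const_one, mul_one, Finset.prod_mul_distrib, Finset.prod_const, prod_ind_miss_apply]

/-- **Mixed moments of hitting events** under the product weight: `E(∏_{j∈B} 1_{H_{A_j}}) = Σ_{R ⊆ B} (−1)^{|R|} ∏_{c ∈ ⋃_{j∈R} A_j} (1 − p_c)`.
[this work; cite: Grimmett1999, §1.3 (product measure)] -/
theorem ex_prod_ind_hit [Fintype ι] [DecidableEq ι] (p : ι → unitInterval) {k : ℕ} (A : Fin k → Finset ι) (B : Finset (Fin k)) :
    ex (bernoulliWeight p) (∏ j ∈ B, ind {ω : Set ι | ∃ a ∈ A j, a ∈ ω})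
      = ∑ R ∈ B.powerset, (-1 : ℝ) ^ R.card * ∏ c ∈ R.biUnion A, (1 - (p c : ℝ)) := by
  have hfun : (∏ j ∈ B, ind {ω : Set ι | ∃ a ∈ A j, a ∈ ω})
      = fun ω => ∑ R ∈ B.powerset, (-1 : ℝ) ^ R.card * ind {ω : Set ι | ∀ c ∈ R.biUnion A, c ∉ ω} ω := by
    funext ω
    rw [Finset.prod_apply, prod_ind_hit_apply_eq_sum]
  rw [hfun, ex_finset_sum]
  refine Finset.sum_congr rfl fun R _ => ?_
  rw [ex_const_mul, ex_bernoulliWeight_ind, prodBernoulli_real_forall_notMem]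

/-- The first moment: `E(1_{H_A}) = 1 − ∏_{c∈A}(1 − p_c)`. [folklore; cite: Grimmett1999, §1.3] -/
theorem ex_ind_hit [Fintype ι] (p : ι → unitInterval) (A : Finset ι) :
    ex (bernoulliWeight p) (ind {ω : Set ι | ∃ a ∈ A, a ∈ ω}) = 1 - ∏ c ∈ A, (1 - (p c : ℝ)) := by
  have hfun : ind {ω : Set ι | ∃ a ∈ A, a ∈ ω} = fun ω => (1 : ℝ) + (-1 : ℝ) * ind {ω : Set ι | ∀ c ∈ A, c ∉ ω} ω := by
    funext ω; rw [ind_hit_apply_eq]; ring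
  rw [hfun]
  have hsplit : (fun ω => (1 : ℝ) + (-1 : ℝ) * ind {ω : Set ι | ∀ c ∈ A, c ∉ ω} ω)
      = (fun _ => (1 : ℝ)) + fun ω => (-1 : ℝ) * ind {ω : Set ι | ∀ c ∈ A, c ∉ ω} ω := rfl
  rw [hsplit, ex_add, ex_const (sum_bernoulliWeight p), ex_const_mul, ex_bernoulliWeight_ind, prodBernoulli_real_forall_notMem]
  ring

end SahiHitting

end Summit.CriticalPhenomena.PercolationContinuityZ3.Theorems
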